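import Literature.AlgebraicTopology.FundamentalGroup.IsotopyTrack
import HarnessLib

/-!
# Tracks of a flow: conjugation of paths by orbit segments, and pushing a path down a flow

Topic `Literature/AlgebraicTopology/FundamentalGroup` (fact seat
`provefact-Literature.Topology.FourManifolds.lauden-f709dd520c`, Laudenbach–Poénaru's Lemma 2: the
loop through a `1`-handle of a handlebody, given by the left-hand disc of a gradient-like field,
has to be rewritten in terms of the orbits of the *unit-speed field of the handle-extension
step* before the effect of a handle slide on it can be read off with `IsotopyTrack.lean`).
Everything here is **proved**; pure point-set bookkeeping over a continuous flow, no named facts.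

**Setting.**  A continuous map `θ : ℝ × M → M` with `θ (0, x) = x` (think: the global flow of a
vector field; the group law is not needed).  Two homotopies of the identity of `M` are built
from it and their track formulas (Hatcher (2002), Lemma 1.19, in the form
`IsotopyTrack.mk_map_eq_of_homotopy`) recorded:

* `flowHomotopy t : id ≃ θ(t, ·)`, `(s, x) ↦ θ (s t, x)`; track of `x` = the orbit segment
  `orbitPath t x : x ⟶ θ (t, x)`.  Consequence (`mk_map_timeMap`): for a path `γ : u ⟶ v`,
  `[θ_t ∘ γ] = [orbitPath t u]⁻¹ · [γ] · [orbitPath t v]` — a loop carried along the flow is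
  conjugate to the original loop by the orbit segment of its base point
  (`mk_orbit_trans_map_timeMap_trans_symm`).
* `pushDownHomotopy f c : id ≃ Π₁`, `(s, x) ↦ θ (-(s · T x), x)` with the *drop time*
  `T x = max (f x - c) 0` of a continuous `f : M → ℝ` (think: a Morse function with
  `f (θ (t, x)) = f x + t` on a slab, so that `Π₁` pushes the part of the slab above the level
  `c` down to that level and is the identity below it).  Consequence (`mk_eq_orbit_trans_pushDown`):
  a path `D : P ⟶ e` ending at a point with `f e ≤ c` satisfies
  `[D] = [s ↦ θ (-(s · T P), P)] · [Π₁ ∘ D]` — it is homotopic, relative to its end points, to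
  the backward orbit segment of its initial point followed by its pushed-down image.
* Under the clock hypothesis `f (θ (t, x)) = f x + t` for `f x, f x + t ∈ (lo, hi)` (the
  unit-speed slabs of `Literature/Topology/FourManifolds/LevelFlowExtension.lean`) and
  `lo < c`, the pushed-down image of `{f < hi}` lies in `{f ≤ c}` (`apply_pushDown_le`).

## References

* A. Hatcher, *Algebraic Topology* (2002), Lemma 1.19. [HatcherAT2002]
* J. Milnor, *Lectures on the h-cobordism theorem* (1965), proof of Thm. 3.4 (PDF p. 13: the
  flow of the normalised gradient-like field moves levels to levels). [MilnorHCobordism1965]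
-/

noncomputable section

open scoped unitInterval Topology
open Set Function

namespace Literature.AlgebraicTopology.FundamentalGroup

namespace FlowTrack

variable {M : Type*} [TopologicalSpace M] {θ : ℝ × M → M} (hθ : Continuous θ) (h0 : ∀ x, θ (0, x) = x)

/-! ### The time-`t` map and orbit segments -/

/-- The time-`t` map `x ↦ θ (t, x)` of the flow, as a continuous map. [folklore] -/
def timeMap (t : ℝ) : C(M, M) :=
  ⟨fun x => θ (t, x), hθ.comp (continuous_const.prodMk continuous_id)⟩

/-- Unfolding. [folklore] -/
@[simp] theorem timeMap_apply (t : ℝ) (x : M) : timeMap hθ t x = θ (t, x) := rfl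

include h0 in
/-- The time-`0` map is the identity. [folklore] -/
theorem timeMap_zero : timeMap hθ 0 = ContinuousMap.id M := by
  ext x; exact h0 x

/-- **The orbit segment** of `x` over the time `t`: the path `s ↦ θ (s t, x)` from `x` to
`θ (t, x)`. [folklore] -/
def orbitPath (t : ℝ) (x : M) : Path x (θ (t, x)) where
  toFun s := θ ((s : ℝ) * t, x)
  continuous_toFun := hθ.comp ((continuous_subtype_val.mul continuous_const).prodMk continuous_const)
  source' := by simp [h0]
  target' := by simp

/-- Unfolding. [folklore] -/
@[simp] theorem orbitPath_apply (t : ℝ) (x : M) (s : I) : orbitPath hθ h0 t x s = θ ((s : ℝ) * t, x) := rfl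

/-- **The flow homotopy** from the identity to the time-`t` map: `(s, x) ↦ θ (s t, x)`.
[cite: HatcherAT2002, Lemma 1.19] -/
def flowHomotopy (t : ℝ) : ContinuousMap.Homotopy (ContinuousMap.id M) (timeMap hθ t) where
  toFun p := θ ((p.1 : ℝ) * t, p.2)
  continuous_toFun := hθ.comp (((continuous_subtype_val.comp continuous_fst).mul continuous_const).prodMk continuous_snd)
  map_zero_left x := by simp [h0]
  map_one_left x := by simp

/-- Unfolding. [folklore] -/
@[simp] theorem flowHomotopy_apply (t : ℝ) (s : I) (x : M) : flowHomotopy hθ h0 t (s, x) = θ ((s : ℝ) * t, x) := rfl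

/-- **A path carried along the flow is conjugate to the original path by the orbit segments of
its end points**: `[θ_t ∘ γ] = [orbitPath t u]⁻¹ · [γ] · [orbitPath t v]` for `γ : u ⟶ v`.
[cite: HatcherAT2002, Lemma 1.19] -/
theorem mk_map_timeMap {u v : M} (γ : Path u v) (t : ℝ) :
    Path.Homotopic.Quotient.mk (γ.map (map_continuous (timeMap hθ t))) =
      ((Path.Homotopic.Quotient.mk (orbitPath hθ h0 t u)).symm.trans (Path.Homotopic.Quotient.mk γ)).trans
        (Path.Homotopic.Quotient.mk (orbitPath hθ h0 t v)) := by
  have h := IsotopyTrack.mk_map_eq_of_homotopy (flowHomotopy hθ h0 t) γ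
  have e₁ : (flowHomotopy hθ h0 t).evalAt u = orbitPath hθ h0 t u := by ext s; rfl
  have e₂ : (flowHomotopy hθ h0 t).evalAt v = orbitPath hθ h0 t v := by ext s; rfl
  have e₃ : γ.map (map_continuous (ContinuousMap.id M)) = γ := by ext s; rfl
  rw [e₁, e₂, e₃] at h
  exact h

/-- Groupoid algebra: `A = O₁⁻¹ · Γ · O₂` solved for `Γ`. [folklore] -/
theorem eq_trans_trans_symm_of_eq {a b c d : M} (O₁ : Path.Homotopic.Quotient a b)
    (Γ : Path.Homotopic.Quotient a c) (O₂ : Path.Homotopic.Quotient c d) (A : Path.Homotopic.Quotient b d)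
    (h : A = (O₁.symm.trans Γ).trans O₂) : Γ = (O₁.trans A).trans O₂.symm := by
  subst h
  simp only [Path.Homotopic.Quotient.trans_assoc, Path.Homotopic.Quotient.trans_symm,
    Path.Homotopic.Quotient.trans_refl]
  rw [← Path.Homotopic.Quotient.trans_assoc, Path.Homotopic.Quotient.trans_symm,
    Path.Homotopic.Quotient.refl_trans]

include hθ h0 in
/-- **A path is conjugate, by the orbit segments of its end points, to the path carried along
the flow**, in the pointwise form used by consumers: if `O₁ : u ⟶ u'`, `O₂ : v ⟶ v'` are the
orbit segments `s ↦ θ (s t, ·)` of `u`, `v` and `δ : u' ⟶ v'` is `θ_t ∘ γ` pointwise, then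
`[γ] = [O₁] · [δ] · [O₂]⁻¹`; in particular a loop `γ` at `u` is conjugate by the orbit segment of
`u` to the loop `θ_t ∘ γ` at `θ (t, u)`. [cite: HatcherAT2002, Lemma 1.19] -/
theorem mk_eq_trans_trans_symm_of_forall_eq {u v u' v' : M} (γ : Path u v) (t : ℝ)
    (O₁ : Path u u') (O₂ : Path v v') (δ : Path u' v')
    (hO₁ : ∀ s : I, O₁ s = θ ((s : ℝ) * t, u)) (hO₂ : ∀ s : I, O₂ s = θ ((s : ℝ) * t, v))
    (hδ : ∀ s : I, δ s = θ (t, γ s)) :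
    Path.Homotopic.Quotient.mk γ =
      ((Path.Homotopic.Quotient.mk O₁).trans (Path.Homotopic.Quotient.mk δ)).trans
        (Path.Homotopic.Quotient.mk O₂).symm := by
  have hu : u' = θ (t, u) := by rw [← O₁.target, hO₁]; simp
  have hv : v' = θ (t, v) := by rw [← O₂.target, hO₂]; simp
  subst hu hv
  have e₁ : O₁ = orbitPath hθ h0 t u := by ext s; exact hO₁ s
  have e₂ : O₂ = orbitPath hθ h0 t v := by ext s; exact hO₂ s
  have e₃ : δ = γ.map (map_continuous (timeMap hθ t)) := by ext s; exact hδ s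
  subst e₁ e₂ e₃
  exact eq_trans_trans_symm_of_eq _ _ _ _ (mk_map_timeMap hθ h0 γ t)

/-! ### Pushing down to a level -/

variable (f : C(M, ℝ)) (c : ℝ)

/-- **The drop time** above the level `c`: `T x = max (f x - c) 0`. [folklore] -/
def dropTime (x : M) : ℝ := max (f x - c) 0

/-- The drop time is continuous. [folklore] -/
theorem continuous_dropTime : Continuous (dropTime f c) :=
  (f.continuous.sub continuous_const).max continuous_const

/-- The drop time is nonnegative. [folklore] -/
theorem dropTime_nonneg (x : M) : 0 ≤ dropTime f c x := le_max_right _ _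

/-- Above the level the drop time is the height above it. [folklore] -/
theorem dropTime_eq_of_le {x : M} (hx : c ≤ f x) : dropTime f c x = f x - c := max_eq_left (sub_nonneg.2 hx)

/-- Below the level the drop time vanishes. [folklore] -/
theorem dropTime_eq_zero_of_le {x : M} (hx : f x ≤ c) : dropTime f c x = 0 := max_eq_right (sub_nonpos.2 hx)

/-- **The push-down map at stage `s`**: `x ↦ θ (-(s · T x), x)`. [cite: MilnorHCobordism1965, proof of Thm. 3.4 (PDF p. 13)] -/
def pushDown (s : ℝ) : C(M, M) :=
  ⟨fun x => θ (-(s * dropTime f c x), x), hθ.comp ((continuous_const.mul (continuous_dropTime f c)).neg.prodMk continuous_id)⟩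

/-- Unfolding. [folklore] -/
@[simp] theorem pushDown_apply (s : ℝ) (x : M) : pushDown hθ f c s x = θ (-(s * dropTime f c x), x) := rfl

include h0 in
/-- Points below the level are not moved. [folklore] -/
theorem pushDown_apply_of_le (s : ℝ) {x : M} (hx : f x ≤ c) : pushDown hθ f c s x = x := by
  simp [dropTime_eq_zero_of_le f c hx, h0]

/-- **The push-down homotopy** from the identity to `Π₁ = pushDown 1`: `(s, x) ↦ θ (-(s · T x), x)`.
[cite: HatcherAT2002, Lemma 1.19] -/
def pushDownHomotopy : ContinuousMap.Homotopy (ContinuousMap.id M) (pushDown hθ f c 1) where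
  toFun p := θ (-((p.1 : ℝ) * dropTime f c p.2), p.2)
  continuous_toFun := hθ.comp ((((continuous_subtype_val.comp continuous_fst).mul
    ((continuous_dropTime f c).comp continuous_snd)).neg).prodMk continuous_snd)
  map_zero_left x := by simp [h0]
  map_one_left x := by simp

/-- Unfolding. [folklore] -/
@[simp] theorem pushDownHomotopy_apply (s : I) (x : M) :
    pushDownHomotopy hθ h0 f c (s, x) = θ (-((s : ℝ) * dropTime f c x), x) := rfl

/-- Bookkeeping: the track formula with a constant final track, rewritten with consumer-supplied
paths (end points equal only propositionally). [folklore] -/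
theorem mk_eq_trans_of_forall_eq {P P₁ P₂ e e₁ : M} (Om : Path P P₁) (Dm : Path P₁ e₁) (ε : Path e e₁)
    (D : Path P e)
    (h : Path.Homotopic.Quotient.mk Dm =
      ((Path.Homotopic.Quotient.mk Om).symm.trans (Path.Homotopic.Quotient.mk D)).trans
        (Path.Homotopic.Quotient.mk ε))
    (O : Path P P₂) (D' : Path P₂ e) (hO : ∀ s, Om s = O s) (hD : ∀ s, Dm s = D' s) (hε : ∀ s, ε s = e) :
    Path.Homotopic.Quotient.mk D = (Path.Homotopic.Quotient.mk O).trans (Path.Homotopic.Quotient.mk D') := by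
  have hP : P₁ = P₂ := by rw [← Om.target, ← O.target]; exact hO 1
  have he : e = e₁ := by rw [← ε.target]; exact (hε 1).symm
  subst hP he
  have E₁ : Om = O := Path.ext (funext hO)
  have E₂ : Dm = D' := Path.ext (funext hD)
  have E₃ : ε = Path.refl e := Path.ext (funext hε)
  subst E₁ E₂ E₃
  rw [Path.Homotopic.Quotient.mk_refl, Path.Homotopic.Quotient.trans_refl] at h
  rw [h, ← Path.Homotopic.Quotient.trans_assoc, Path.Homotopic.Quotient.trans_symm,
    Path.Homotopic.Quotient.refl_trans]

include hθ h0 in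
/-- **A path ending below the level is homotopic, relative to its end points, to the backward
orbit segment of its initial point followed by its pushed-down image**: for `D : P ⟶ e` with
`f e ≤ c`, and consumer-supplied paths `O : P ⟶ P'` equal to `s ↦ θ (-(s · T P), P)` and
`D' : P' ⟶ e` equal to `Π₁ ∘ D` pointwise, `[D] = [O] · [D']`. [cite: HatcherAT2002, Lemma 1.19] -/
theorem mk_eq_orbit_trans_pushDown {P e P' : M} (D : Path P e) (he : f e ≤ c)
    (O : Path P P') (hO : ∀ s : I, O s = θ (-((s : ℝ) * dropTime f c P), P))
    (D' : Path P' e) (hD' : ∀ s : I, D' s = θ (-(dropTime f c (D s)), D s)) :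
    Path.Homotopic.Quotient.mk D = (Path.Homotopic.Quotient.mk O).trans (Path.Homotopic.Quotient.mk D') := by
  set F := pushDownHomotopy hθ h0 f c with hF
  have h := IsotopyTrack.mk_map_eq_of_homotopy F D
  have e₄ : D.map (map_continuous (ContinuousMap.id M)) = D := by ext s; rfl
  rw [e₄] at h
  refine mk_eq_trans_of_forall_eq (F.evalAt P) (D.map (map_continuous (pushDown hθ f c 1))) (F.evalAt e) D h
    O D' (fun s => ?_) (fun s => ?_) (fun s => ?_)
  · exact Eq.trans rfl (hO s).symm
  · show θ (-(1 * dropTime f c (D s)), D s) = D' s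
    rw [one_mul]; exact (hD' s).symm
  · show θ (-((s : ℝ) * dropTime f c e), e) = e
    rw [dropTime_eq_zero_of_le f c he, mul_zero, neg_zero, h0]

/-! ### Levels under a clock -/

variable {f c} {lo hi : ℝ}

include h0 in
/-- **Levels along the push-down, under a clock.**  If `f (θ (t, x)) = f x + t` whenever `f x`
and `f x + t` lie in `(lo, hi)`, and `lo < c`, then for `f x < hi` and `s ∈ [0, 1]` the stage-`s`
push-down of `x` lies at the level `f x - s · T x ∈ [min (f x) c, f x]`; in particular
`Π₁ x` lies at the level `min (f x) c ≤ c`. [cite: MilnorHCobordism1965, proof of Thm. 3.4 (PDF p. 13)] -/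
theorem apply_pushDown_eq (hclock : ∀ x t, f x ∈ Ioo lo hi → f x + t ∈ Ioo lo hi → f (θ (t, x)) = f x + t)
    (hc : lo < c) {x : M} (hx : f x < hi) {s : ℝ} (hs : s ∈ Icc (0 : ℝ) 1) :
    f (pushDown hθ f c s x) = f x - s * dropTime f c x := by
  rw [pushDown_apply]
  by_cases hxc : f x ≤ c
  · rw [dropTime_eq_zero_of_le f c hxc, mul_zero, neg_zero, h0, sub_zero]
  · push Not at hxc
    rw [dropTime_eq_of_le f c hxc.le]
    have h1 : 0 ≤ s * (f x - c) := mul_nonneg hs.1 (by linarith)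
    have h2 : s * (f x - c) ≤ f x - c := by nlinarith [hs.2]
    rw [hclock x (-(s * (f x - c))) ⟨by linarith, hx⟩ ⟨by linarith, by linarith⟩]
    ring

include h0 in
/-- The pushed-down point lies at a level `≤ c` (and `≤ f x`). [cite: MilnorHCobordism1965, proof of Thm. 3.4 (PDF p. 13)] -/
theorem apply_pushDown_one_le (hclock : ∀ x t, f x ∈ Ioo lo hi → f x + t ∈ Ioo lo hi → f (θ (t, x)) = f x + t)
    (hc : lo < c) {x : M} (hx : f x < hi) : f (pushDown hθ f c 1 x) ≤ c := by
  rw [apply_pushDown_eq hθ h0 hclock hc hx ⟨zero_le_one, le_rfl⟩, one_mul]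
  unfold dropTime
  rcases le_total (f x - c) 0 with h | h
  · rw [max_eq_right h]; linarith
  · rw [max_eq_left h]; linarith

include h0 in
/-- Above the level, the pushed-down point lies exactly on the level `c`. [cite: MilnorHCobordism1965, proof of Thm. 3.4 (PDF p. 13)] -/
theorem apply_pushDown_one_eq (hclock : ∀ x t, f x ∈ Ioo lo hi → f x + t ∈ Ioo lo hi → f (θ (t, x)) = f x + t)
    (hc : lo < c) {x : M} (hx : f x < hi) (hxc : c ≤ f x) : f (pushDown hθ f c 1 x) = c := by
  rw [apply_pushDown_eq hθ h0 hclock hc hx ⟨zero_le_one, le_rfl⟩, one_mul, dropTime_eq_of_le f c hxc]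
  ring

include h0 in
/-- The levels along the push-down stay in `[min (f x) c, f x]`; in particular below `hi` and
above `lo`. [cite: MilnorHCobordism1965, proof of Thm. 3.4 (PDF p. 13)] -/
theorem apply_pushDown_mem (hclock : ∀ x t, f x ∈ Ioo lo hi → f x + t ∈ Ioo lo hi → f (θ (t, x)) = f x + t)
    (hc : lo < c) {x : M} (hx : f x < hi) {s : ℝ} (hs : s ∈ Icc (0 : ℝ) 1) :
    f (pushDown hθ f c s x) ∈ Icc (min (f x) c) (f x) := by
  rw [apply_pushDown_eq hθ h0 hclock hc hx hs]
  unfold dropTime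
  rcases le_total (f x - c) 0 with h | h
  · rw [max_eq_right h, mul_zero, sub_zero]; exact ⟨min_le_left _ _, le_rfl⟩
  · rw [max_eq_left h]
    have h1 : 0 ≤ s * (f x - c) := mul_nonneg hs.1 h
    have h2 : s * (f x - c) ≤ f x - c := by nlinarith [hs.2]
    exact ⟨by rw [min_eq_right (by linarith)]; linarith, by linarith⟩

include hθ h0 in
/-- **The backward orbit segment of the push-down**, under a clock: the track
`s ↦ θ (-(s · T P), P)` of a point `P` with `c ≤ f P < hi` runs from `P` down to the level `c`,
through the levels `f P - s (f P - c)`. [cite: MilnorHCobordism1965, proof of Thm. 3.4 (PDF p. 13)] -/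
theorem apply_track_eq (hclock : ∀ x t, f x ∈ Ioo lo hi → f x + t ∈ Ioo lo hi → f (θ (t, x)) = f x + t)
    (hc : lo < c) {P : M} (hP : f P < hi) (hPc : c ≤ f P) {s : ℝ} (hs : s ∈ Icc (0 : ℝ) 1) :
    f (θ (-(s * dropTime f c P), P)) = f P - s * (f P - c) := by
  have h := apply_pushDown_eq hθ h0 hclock hc hP hs
  rw [pushDown_apply] at h
  rwa [dropTime_eq_of_le f c hPc] at h ⊢

end FlowTrack

end Literature.AlgebraicTopology.FundamentalGroup
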